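import Mathlib
import Summits.NavierStokesRegularity.NavierStokesRegularity.Theorems.ThreadingFluxHorizonTowerQuadraticGeneratorCone
import HarnessLib

/-!
# Crux `PoloidalLiouville` (stmt-NavierStokesRegularity-1222), crux idea «horizon-threading-tower» (ns-idea-15):
# THE FOURTH CONE DIGIT, IV — the digit-4 numerator `N₄(m,n) ≠ 0` and the `μ²` coprimality exit

Support file (`--supports stmt-NavierStokesRegularity-1222`, helper; cell `ns-wall-extremal`, width hand ns-wall-eng-3 g7; 0 kit), toward
THM K (`FiniteTowerGcdTwoTwoShellsHorizonTowerZonality`).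
* ★ `fourthDigit_numerator_ne_zero`: the digit-4 numerator
  `N₄(m,n) = 48m⁴n² + 192m³n³ + 144m²n⁴ + 96m⁴n + 648m³n² + 320m²n³ + 1304mn⁴ + 45m⁴ + 618m³n − 1425m²n² + 7314mn³ + 512n⁴ + 180m³`
  `− 4248m²n + 14496mn² + 2884n³ − 2680m² + 11948mn + 5868n² + 3480m + 5096n + 1600` does not vanish for `m < n`
  (`N₄(m, m+d+1)` has all 25 coefficients positive).  It is the closed form (found by the seat's exact reduced-algebra CAS over 195 towers
  and re-derived by ns-wall-crit-1 g8) of the `M²`-slot coefficient of the fourth `ρ`-adic digit: in the tower's normalisation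
  `K₂₂ = 679477248·(4m+7)³(4m+3)(4m+5)·c₁·g₂(n+2)·z_b·g₁g₂·c₀(m−n)(m+2)(n+2)·N₄(m,n)`.
* ★ `eq_zero_of_chartT_genL_dvd_sq`: for a real traceless symmetric `Q` with `W = det(x,Qx,Q²x) ≢ 0`, if `chartT L` divides
  `c · chartT W · (chartT M)²` then `c = 0` — the `μ²` version of `eq_zero_of_chartT_genL_dvd` (same root argument: at a root `ε` of
  `chartT L`, `W(ε)M(ε)² = 0` forces `M(ε) = 0`, impossible off the uniaxial locus).

HONEST LABEL: polynomial algebra about one crux idea's typed objects; no Prop of the sketch is closed here; `HorizonTowerZonality`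
(general towers), `PoloidalLiouville` (1222) OPEN; NS regularity NOT proved.  [folklore]
-/

-- the summit and its single sub-problem share the name (CONVENTIONS §1)
set_option linter.dupNamespace false

noncomputable section

open MvPolynomial Polynomial

namespace Summit.NavierStokesRegularity.NavierStokesRegularity.Theorems.PoloidalLiouville.HorizonTower.Zonal

/-- ★ The digit-4 numerator `N₄(m,n)` does not vanish for `m < n`: `N₄(m, m+d+1) = 384m⁶ + 1248m⁵d + 1488m⁴d² + 768m³d³ + 144m²d⁴
+ 3616m⁵ + 10544m⁴d + 11736m³d² + 6112m²d³ + 1304md⁴ + 16120m⁴ + 42926m³d + 41061m²d² + 14578md³ + 512d⁴ + 45270m³ + 97758m²d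
+ 59058md² + 4932d³ + 77801m² + 103282md + 17592d² + 66074m + 27532d + 15960 > 0`. [folklore] -/
theorem fourthDigit_numerator_ne_zero {m n : ℕ} (hmn : m < n) :
    (48 * (m : ℝ) ^ 4 * (n : ℝ) ^ 2 + 192 * (m : ℝ) ^ 3 * (n : ℝ) ^ 3 + 144 * (m : ℝ) ^ 2 * (n : ℝ) ^ 4 + 96 * (m : ℝ) ^ 4 * n
      + 648 * (m : ℝ) ^ 3 * (n : ℝ) ^ 2 + 320 * (m : ℝ) ^ 2 * (n : ℝ) ^ 3 + 1304 * (m : ℝ) * (n : ℝ) ^ 4 + 45 * (m : ℝ) ^ 4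
      + 618 * (m : ℝ) ^ 3 * n - 1425 * (m : ℝ) ^ 2 * (n : ℝ) ^ 2 + 7314 * (m : ℝ) * (n : ℝ) ^ 3 + 512 * (n : ℝ) ^ 4 + 180 * (m : ℝ) ^ 3
      - 4248 * (m : ℝ) ^ 2 * n + 14496 * (m : ℝ) * (n : ℝ) ^ 2 + 2884 * (n : ℝ) ^ 3 - 2680 * (m : ℝ) ^ 2 + 11948 * (m : ℝ) * n
      + 5868 * (n : ℝ) ^ 2 + 3480 * (m : ℝ) + 5096 * (n : ℝ) + 1600) ≠ 0 := by
  obtain ⟨d, rfl⟩ : ∃ d, n = m + d + 1 := ⟨n - m - 1, by omega⟩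
  push_cast
  have hm : (0 : ℝ) ≤ m := Nat.cast_nonneg m
  have hd : (0 : ℝ) ≤ d := Nat.cast_nonneg d
  have hpos : (0 : ℝ) < 384 * (m : ℝ) ^ 6 + 1248 * (m : ℝ) ^ 5 * d + 1488 * (m : ℝ) ^ 4 * (d : ℝ) ^ 2 + 768 * (m : ℝ) ^ 3 * (d : ℝ) ^ 3
      + 144 * (m : ℝ) ^ 2 * (d : ℝ) ^ 4 + 3616 * (m : ℝ) ^ 5 + 10544 * (m : ℝ) ^ 4 * d + 11736 * (m : ℝ) ^ 3 * (d : ℝ) ^ 2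
      + 6112 * (m : ℝ) ^ 2 * (d : ℝ) ^ 3 + 1304 * (m : ℝ) * (d : ℝ) ^ 4 + 16120 * (m : ℝ) ^ 4 + 42926 * (m : ℝ) ^ 3 * d
      + 41061 * (m : ℝ) ^ 2 * (d : ℝ) ^ 2 + 14578 * (m : ℝ) * (d : ℝ) ^ 3 + 512 * (d : ℝ) ^ 4 + 45270 * (m : ℝ) ^ 3
      + 97758 * (m : ℝ) ^ 2 * d + 59058 * (m : ℝ) * (d : ℝ) ^ 2 + 4932 * (d : ℝ) ^ 3 + 77801 * (m : ℝ) ^ 2 + 103282 * (m : ℝ) * d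
      + 17592 * (d : ℝ) ^ 2 + 66074 * (m : ℝ) + 27532 * (d : ℝ) + 15960 := by positivity
  intro h
  nlinarith [h, hpos]

section Real

variable (a b d e f : ℝ)

/-- ★ **THE GENERATOR CHARTS ARE COPRIME OFF THE UNIAXIAL LOCUS, `μ²` form.**  For a real traceless symmetric `Q` with
`W = det(x,Qx,Q²x) ≢ 0`: if `chartT L` divides `c · chartT W · (chartT M)²` then `c = 0`.  This is what the FOURTH cone digit needs
(`K₂₂ · L^s · M² · W ≡ L^{s+1}·(…) (mod ρ)`). [folklore] -/
theorem eq_zero_of_chartT_genL_dvd_sq (hW : genW a b d e f ≠ 0) {c : ℂ}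
    (hdiv : chartT (map (algebraMap ℝ ℂ) (genL a b d e f))
      ∣ Polynomial.C c * (chartT (map (algebraMap ℝ ℂ) (genW a b d e f)) * chartT (map (algebraMap ℝ ℂ) (genM a b d e f)) ^ 2)) :
    c = 0 := by
  have hL : genL a b d e f ≠ 0 := by
    intro h0
    obtain ⟨ha, hb, hd, he, hf⟩ := gen_eq_zero_of_genL_eq_zero (a := (a : ℂ)) (b := b) (d := d) (e := e) (f := f)
      (by rw [← Complex.coe_algebraMap, ← map_genL, h0, map_zero])
    apply hW
    rw [Complex.ofReal_eq_zero] at ha hb hd he hf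
    subst ha; subst hb; subst hd; subst he; subst hf
    simp [genW, genQ0, genQ1, genQ2, genS0, genS1, genS2]
  obtain ⟨t₀, ht₀⟩ := Complex.exists_root (degree_chartT_genL_pos a b d e f hL)
  set ε : Fin 3 → ℂ := isoVec 1 t₀ with hε
  have hε0 : ε ≠ 0 := isoVec_one_ne_zero t₀
  have hLε : eval ε (map (algebraMap ℝ ℂ) (genL a b d e f)) = 0 := by rw [hε, ← eval_chartT]; exact ht₀
  have hρε : eval ε (map (algebraMap ℝ ℂ) (normSq : RPoly)) = 0 := by
    rw [eval_map_normSq, hε]; exact isoVec_sq_sum 1 t₀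
  have hprod := Polynomial.eval_eq_zero_of_dvd_of_eval_eq_zero hdiv ht₀
  rw [Polynomial.eval_mul, Polynomial.eval_mul, Polynomial.eval_pow, Polynomial.eval_C, eval_chartT, eval_chartT, ← hε] at hprod
  rcases mul_eq_zero.mp hprod with hc | hWM
  · exact hc
  · exfalso
    have hMε : eval ε (map (algebraMap ℝ ℂ) (genM a b d e f)) = 0 := by
      rcases mul_eq_zero.mp hWM with hWε | hMε
      · have h := eval_genW_sq_of_cone a b d e f hρε hLε
        rw [hWε, zero_pow two_ne_zero, eq_comm, neg_eq_zero] at h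
        exact (pow_eq_zero_iff three_ne_zero).mp h
      · exact (pow_eq_zero_iff two_ne_zero).mp hMε
    exact hε0 (eq_zero_of_cone_zero a b d e f hW hρε hLε hMε)

end Real

end Summit.NavierStokesRegularity.NavierStokesRegularity.Theorems.PoloidalLiouville.HorizonTower.Zonal

end
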